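import Summits.QuantumFields.YangMills.Theses.FradkinShenkerFlow
import Literature.MathematicalPhysics.QuantumLattice.TorusWilsonGibbs
import Summits.QuantumFields.YangMills.Theorems.FradkinShenkerFlowSusceptibilityToPoincareHaarResample
import Summits.QuantumFields.YangMills.Theorems.FradkinShenkerFlowSusceptibilityToPoincareOrbitSliceSplit
import Summits.QuantumFields.YangMills.Theorems.FradkinShenkerFlowSusceptibilityToPoincareOrbitEfronStein
import Summits.QuantumFields.YangMills.Theorems.FradkinShenkerFlowSusceptibilityToPoincareLocalPoincareKernelVariance

/-!
# Stub `stub_localPoincare_smallCylinders` of the line `maxcorr-halving` (crux `SusceptibilityToPoincare`)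

Route `FradkinShenkerFlow` of `YangMills`, crux item `stmt-QuantumFields-9441`
(`Summit.QuantumFields.YangMills.Theses.FradkinShenkerFlow.SusceptibilityToPoincare`, FS ⇒ UP).
This file proves stub C3 of the registered skeleton `Cruxes/SusceptibilityToPoincare/Lines/maxcorr-halving.lean`:
the **per-volume Poincaré inequality for small cylinders, uniformly in the volume and in the
exterior** (the base case of Martinelli's bisection). For the 4D torus of side `2S+1`, the Wilson
measure `μ = wilsonMeasure r.ρ β`, a cylinder `Q = {x | ∀ ν, (x ν − a ν).val < n ν}` with all
sides `n ν ≤ m`, its exterior links `ext = {ℓ | ℓ.1 ∉ Q}` and a bounded measurable `F`, there is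
`C = C(m, G, r, β)`, independent of `S`, of the position `a` and of the exterior configuration, with

  `∫ (F − μ[F | 𝓕_ext])² dμ ≤ C Σ_{ℓ : ℓ.1 ∈ Q} ∫∫ (F U − F(U[ℓ ↦ g]))² dν_ℓ^U(g) dμ(U)`,

`ν_ℓ^U = Haar.tilted (−β S_W(U[ℓ ↦ ·]))` the one-link heat-bath law; here
`C = ½ e^{2c₁ + c₂}`, `c₁ = |β| · 2 · (4m⁴ · 5 · 6) (N + M_t)`, `c₂ = |β| · 2 · (5 · 6) (N + M_t)`.

## Proof

* *Conditional variance = averaged kernel variance.* The torus Wilson state is a DLR state of the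
  plaquette specification `γ` (`exists_plaquettePotential`, `isGibbsMeasure_wilsonMeasure`), so
  with `Λ` = links based in `Q` (`(↑Λ)ᶜ = ext`) the kernel average `m = γ_Λ F` is a version of
  `μ[F | 𝓕_ext]` (`IsGibbsMeasure.condExp_ae_eq_integral`); by the DLR equation
  (`IsGibbsMeasure.integral_integral_eq`) `∫ (F − m)² dμ = ∫∫ (F σ − m σ)² dγ_Λ(·|η) dμ(η)`, and
  `m σ = m η` for `γ_Λ(·|η)`-a.e. `σ` (properness, and locality of `m`,
  `dependsOn_integral_gibbsSpecOfPotential`).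
* *Inside one kernel* (`LocalPoincare.integral_sub_sq_kernel_le`, registered sub-goal
  `stub_localPoincare_kernelVariance` of the helper module
  `FradkinShenkerFlowSusceptibilityToPoincareLocalPoincareKernelVariance`): `γ_Λ(·|η)` is the glued product
  Haar measure `π_η = Haar^{⊗Λ} ∘ glueWith⁻¹(·, η)` tilted by `φ = −β H_Λ`, whose oscillation over
  glued configurations equals that of `−β S_W` (`dependsOn_hamiltonianIn_sub`), at most `c₁`
  uniformly in the volume (`LocalPoincare.abs_wilsonAction_sub_le`: shadow/bulk split of the
  action; `LocalPoincare.card_filter_fst_mem_le`: `#Λ ≤ 4m⁴`). Holley–Stroock: the variance is at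
  most the second moment about the `π_η`-mean, the tilted density lies in `[e^{−c₁}, e^{c₁}]`
  (`HaarResample.integral_le_exp_mul_integral_tilted` and its converse
  `LocalPoincare.integral_tilted_le_exp_mul_integral`), and in between the tree's **Efron–Stein
  inequality** (`Literature.Probability.Moments.EfronSteinInequality_holds`) on `(Λ → G, Haar^{⊗Λ})`
  for `ζ ↦ F(glueWith Λ ζ η)`, with `glueWith Λ (update ζ i y) η = update (glueWith Λ ζ η) i y`;
  everything is transported along the gluing map (`LocalPoincare.integral_tilted_map_eq`).
* *DLR backwards and Haar → heat bath.* Integrating in `η`, the DLR equation turns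
  `∫∫ Ψ_ℓ dγ_Λ dμ` into `∫ Ψ_ℓ dμ`, `Ψ_ℓ(U) = ∫ (F U − F(U[ℓ ↦ h]))² dHaar(h)`, and Haar resampling of
  one link costs at most `e^{c₂}` times heat-bath resampling (landed
  `HaarResample.integral_haar_le_exp_mul_integral_heatBath`). Every compact `G`, real `β`, all `S`.
-/

noncomputable section

open MeasureTheory ProbabilityTheory
open Literature.MathematicalPhysics.QuantumFieldTheory
open Literature.Probability.LatticeModels
open Literature.MathematicalPhysics.QuantumLattice (exists_plaquettePotential
  isGibbsMeasure_wilsonMeasure dependsOn_integral_gibbsSpecOfPotential)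

namespace Summit.QuantumFields.YangMills.Theorems.SusceptibilityToPoincare

namespace LocalPoincare

/-! ### The torus Wilson measure: local Poincaré inequality for small cylinders -/

section Torus

variable {G : Type} [Group G] [TopologicalSpace G] [IsTopologicalGroup G] [CompactSpace G]
  [MeasurableSpace G] [BorelSpace G]

/-- **Per-volume Poincaré inequality for a small cylinder, uniformly in the volume and in the
exterior** (explicit constant). For the torus Wilson measure `μ = wilsonMeasure r.ρ β` on
`(ℤ/(2S+1))⁴`, a cylinder `Q` with all sides `≤ m`, and a measurable `F` with `|F| ≤ M`:
`E_μ(F − E_μ[F | links based outside Q])² ≤ ½ e^{2c₁ + c₂} Σ_{ℓ based in Q} ∫∫ (F U − F(U[ℓ ↦ g]))² dν_ℓ^U(g) dμ(U)`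
with `c₁ = |β| · 2 · (4m⁴ · 5 · #{planes}) (N + M_t)`, `c₂ = |β| · 2 · (5 · #{planes}) (N + M_t)`.
Proof: the conditional expectation is the kernel average of the plaquette specification
(`isGibbsMeasure_wilsonMeasure`, `IsGibbsMeasure.condExp_ae_eq_integral`); by the DLR equation and
properness the conditional variance is the `μ`-average of the kernel variances; inside a kernel,
Holley–Stroock against glued product Haar measure and Efron–Stein
(`integral_sub_sq_kernel_le`, oscillation of the tilt = oscillation of the Wilson action,
`abs_wilsonAction_sub_le`); DLR backwards; Haar resampling of one link is dominated by heat-bath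
resampling (`HaarResample.integral_haar_le_exp_mul_integral_heatBath`). [folklore] -/
theorem integral_sub_condExp_sq_le (r : LatticeRep G) (β : ℝ) {Mt : ℝ} (hMt0 : 0 ≤ Mt)
    (hMt : ∀ g, |(r.ρ g).trace.re| ≤ Mt) {m : ℕ} (S : ℕ) (a : Fin 4 → ZMod (2 * S + 1))
    (n : Fin 4 → ℕ) (hnm : ∀ ν, n ν ≤ m) (Q : Set (Site 4 (2 * S + 1)))
    (hQ : Q = {x | ∀ ν, (x ν - a ν).val < n ν}) {F : GaugeConfig 4 (2 * S + 1) G → ℝ}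
    (hF : Measurable F) {M : ℝ} (hM : ∀ U, |F U| ≤ M) :
    ∫ U, (F U - ((wilsonMeasure r.ρ β : Measure (GaugeConfig 4 (2 * S + 1) G))[F|
        cylinderEvents {ℓ : Edge 4 (2 * S + 1) | ℓ.1 ∉ Q}]) U) ^ 2
        ∂(wilsonMeasure r.ρ β : Measure (GaugeConfig 4 (2 * S + 1) G)) ≤
      Real.exp (|β| * (2 * (((4 * m ^ 4 * (4 + 1) *
          Fintype.card {q : Fin 4 × Fin 4 // q.1 < q.2} : ℕ) : ℝ) * ((r.N : ℝ) + Mt)))) *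
        Real.exp (|β| * (2 * (((4 * m ^ 4 * (4 + 1) *
          Fintype.card {q : Fin 4 × Fin 4 // q.1 < q.2} : ℕ) : ℝ) * ((r.N : ℝ) + Mt)))) *
        (1 / 2 : ℝ) *
        Real.exp (|β| * (2 * ((((4 + 1) * Fintype.card {q : Fin 4 × Fin 4 // q.1 < q.2} : ℕ) :
          ℝ) * ((r.N : ℝ) + Mt)))) *
      ∑ ℓ : Edge 4 (2 * S + 1), Set.indicator {ℓ : Edge 4 (2 * S + 1) | ℓ.1 ∈ Q}
        (fun ℓ => ∫ U, ∫ g, (F U - F (Function.update U ℓ g)) ^ 2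
          ∂((haarProbability G).tilted (fun g' => -β * wilsonAction r.ρ (Function.update U ℓ g')))
          ∂(wilsonMeasure r.ρ β : Measure (GaugeConfig 4 (2 * S + 1) G))) ℓ := by
  classical
  haveI : SecondCountableTopology G :=
    (r.continuous.isClosedEmbedding r.injective).isEmbedding.secondCountableTopology
  haveI : T2Space G := (r.continuous.isClosedEmbedding r.injective).isEmbedding.t2Space
  set μ : Measure (GaugeConfig 4 (2 * S + 1) G) := wilsonMeasure r.ρ β with hμdef
  haveI : IsProbabilityMeasure μ :=
    isProbabilityMeasure_wilsonMeasure (d := 4) (L := 2 * S + 1) r.ρ r.continuous β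
  set P : ℕ := Fintype.card {q : Fin 4 × Fin 4 // q.1 < q.2} with hP
  set c₁ : ℝ := |β| * (2 * (((4 * m ^ 4 * (4 + 1) * P : ℕ) : ℝ) * ((r.N : ℝ) + Mt))) with hc₁
  set c₂ : ℝ := |β| * (2 * ((((4 + 1) * P : ℕ) : ℝ) * ((r.N : ℝ) + Mt))) with hc₂
  set hb : Edge 4 (2 * S + 1) → ℝ := fun ℓ => ∫ U, ∫ g, (F U - F (Function.update U ℓ g)) ^ 2
    ∂((haarProbability G).tilted (fun g' => -β * wilsonAction r.ρ (Function.update U ℓ g'))) ∂μ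
    with hhb
  -- the links based in `Q`
  set Λ : Finset (Edge 4 (2 * S + 1)) := Finset.univ.filter fun ℓ => ℓ.1 ∈ Q with hΛ
  have hΛc : {ℓ : Edge 4 (2 * S + 1) | ℓ.1 ∉ Q} = (↑Λ : Set (Edge 4 (2 * S + 1)))ᶜ := by
    ext ℓ; simp [hΛ]
  have hcard : Λ.card ≤ 4 * m ^ 4 := card_filter_fst_mem_le a n hnm Q hQ
  -- the Gibbs structure of `μ`
  obtain ⟨Φ, supp, hΦ, hΦb, hsupp, hH, -⟩ :=
    exists_plaquettePotential (d := 4) (L := 2 * S + 1) r.ρ r.continuous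
  set γ : Specification (Edge 4 (2 * S + 1)) G :=
    gibbsSpecOfPotential (haarProbability G) Φ supp β with hγdef
  have hγ : IsSpecification γ :=
    isSpecification_gibbsSpecOfPotential (haarProbability G) hΦ hΦb hsupp β
  have hGibbs : IsGibbsMeasure γ μ :=
    isGibbsMeasure_wilsonMeasure r.ρ r.continuous hΦ hΦb hsupp hH β
  haveI hγprob : ∀ η, IsProbabilityMeasure (γ Λ η) := fun η => hγ.isProbability Λ η
  let κk : Kernel (GaugeConfig 4 (2 * S + 1) G) (GaugeConfig 4 (2 * S + 1) G) :=
    ⟨γ Λ, hγ.measurable_fun Λ⟩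
  -- the tilt of the `Λ`-kernel: bounded, measurable, oscillation `≤ c₁` over glued configurations
  set φΛ : GaugeConfig 4 (2 * S + 1) G → ℝ := fun σ => -β * hamiltonianIn Φ supp Λ σ with hφΛ
  have hφm : Measurable φΛ := (measurable_hamiltonianIn (fun A => (hΦ A).2) supp Λ).const_mul _
  have hφb : ∃ A, ∀ σ, |φΛ σ| ≤ A := by
    choose C hC using hΦb
    refine ⟨|β| * ∑ A ∈ supp Λ with (A ∩ Λ).Nonempty, C A, fun σ => ?_⟩
    rw [hφΛ, abs_mul, abs_neg]
    exact mul_le_mul_of_nonneg_left (abs_hamiltonianIn_le hC supp Λ σ) (abs_nonneg β)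
  have hosc : ∀ (η : GaugeConfig 4 (2 * S + 1) G) (ζ ζ' : Λ → G),
      φΛ (glueWith Λ ζ' η) ≤ φΛ (glueWith Λ ζ η) + c₁ := by
    intro η ζ ζ'
    have hagree : ∀ e, e ∉ Λ → glueWith Λ ζ' η e = glueWith Λ ζ η e := fun e he => by
      rw [glueWith_apply_not_mem _ _ _ he, glueWith_apply_not_mem _ _ _ he]
    have hdep : hamiltonianIn Φ supp Finset.univ (glueWith Λ ζ' η) -
        hamiltonianIn Φ supp Λ (glueWith Λ ζ' η) =
        hamiltonianIn Φ supp Finset.univ (glueWith Λ ζ η) -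
        hamiltonianIn Φ supp Λ (glueWith Λ ζ η) :=
      dependsOn_hamiltonianIn_sub hΦ hsupp (Finset.subset_univ Λ)
        (fun e he => hagree e (fun h => he (Finset.mem_coe.2 h)))
    rw [hH, hH] at hdep
    have hW : |wilsonAction r.ρ (glueWith Λ ζ' η) - wilsonAction r.ρ (glueWith Λ ζ η)| ≤
        2 * (((4 * m ^ 4 * (4 + 1) * P : ℕ) : ℝ) * ((r.N : ℝ) + Mt)) := by
      refine (abs_wilsonAction_sub_le r.ρ hMt Λ hagree).trans ?_
      have hNM : 0 ≤ (r.N : ℝ) + Mt := by positivity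
      refine mul_le_mul_of_nonneg_left (mul_le_mul_of_nonneg_right ?_ hNM) (by norm_num)
      exact_mod_cast Nat.mul_le_mul_right _ (Nat.mul_le_mul_right _ hcard)
    have hkey : φΛ (glueWith Λ ζ' η) - φΛ (glueWith Λ ζ η) =
        -β * (wilsonAction r.ρ (glueWith Λ ζ' η) - wilsonAction r.ρ (glueWith Λ ζ η)) := by
      rw [hφΛ]
      linear_combination β * hdep
    have hle : φΛ (glueWith Λ ζ' η) - φΛ (glueWith Λ ζ η) ≤ c₁ := by
      rw [hkey]
      calc -β * (wilsonAction r.ρ (glueWith Λ ζ' η) - wilsonAction r.ρ (glueWith Λ ζ η))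
          ≤ |-β * (wilsonAction r.ρ (glueWith Λ ζ' η) - wilsonAction r.ρ (glueWith Λ ζ η))| :=
            le_abs_self _
        _ = |β| * |wilsonAction r.ρ (glueWith Λ ζ' η) - wilsonAction r.ρ (glueWith Λ ζ η)| := by
            rw [abs_mul, abs_neg]
        _ ≤ |β| * (2 * (((4 * m ^ 4 * (4 + 1) * P : ℕ) : ℝ) * ((r.N : ℝ) + Mt))) :=
            mul_le_mul_of_nonneg_left hW (abs_nonneg β)
        _ = c₁ := by rw [hc₁]
    linarith
  -- the kernel average `mF` of `F`: a version of the conditional expectation, local, bounded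
  set mF : GaugeConfig 4 (2 * S + 1) G → ℝ := fun η => ∫ σ, F σ ∂(γ Λ η) with hmF
  have hcond : μ[F|cylinderEvents (X := fun _ : Edge 4 (2 * S + 1) => G)
      ((↑Λ : Set (Edge 4 (2 * S + 1)))ᶜ)] =ᵐ[μ] mF :=
    hGibbs.condExp_ae_eq_integral hγ Λ hF hM
  have hmFm : Measurable mF := (hF.stronglyMeasurable.integral_kernel (κ := κk)).measurable
  have hmFb : ∀ η, |mF η| ≤ M := fun η => by
    have := norm_integral_le_of_norm_le_const (μ := γ Λ η) (C := M) (f := F)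
      (ae_of_all _ fun σ => by rw [Real.norm_eq_abs]; exact hM σ)
    simpa only [Real.norm_eq_abs, probReal_univ, mul_one] using this
  have hmFdep : DependsOn mF ((↑Λ : Set (Edge 4 (2 * S + 1)))ᶜ) :=
    dependsOn_integral_gibbsSpecOfPotential (haarProbability G) hΦ supp β Λ
      (T := ((↑Λ : Set (Edge 4 (2 * S + 1)))ᶜ))
      (fun A _ _ => by rw [Set.union_compl_self]; exact Set.subset_univ _)
      hF.stronglyMeasurable (by rw [Set.union_compl_self]; exact dependsOn_univ F)
  -- the Haar resampling costs `Ψ i σ = ∫ (F σ − F(σ[i ↦ y]))² dHaar(y)`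
  set Ψ : Λ → GaugeConfig 4 (2 * S + 1) G → ℝ := fun i σ =>
    ∫ y, (F σ - F (Function.update σ (↑i) y)) ^ 2 ∂(haarProbability G) with hΨ
  have hDm : ∀ i : Λ, Measurable fun q : GaugeConfig 4 (2 * S + 1) G × G =>
      (F q.1 - F (Function.update q.1 (↑i) q.2)) ^ 2 :=
    fun i => ((hF.comp measurable_fst).sub (hF.comp measurable_update')).pow_const 2
  have hΨm : ∀ i, Measurable (Ψ i) := fun i =>
    ((hDm i).stronglyMeasurable.integral_prod_right' (ν := haarProbability G)).measurable
  have hΨ0 : ∀ i σ, 0 ≤ Ψ i σ := fun i σ => integral_nonneg fun _ => sq_nonneg _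
  have hΨB : ∀ i σ, Ψ i σ ≤ (2 * M) ^ 2 := fun i σ => by
    have := norm_integral_le_of_norm_le_const (μ := haarProbability G) (C := (2 * M) ^ 2)
      (f := fun y => (F σ - F (Function.update σ (↑i) y)) ^ 2)
      (ae_of_all _ fun y => OrbitES.norm_sq_sub_le (hM _) (hM _))
    rw [probReal_univ, mul_one, Real.norm_eq_abs, abs_of_nonneg (hΨ0 i σ)] at this
    exact this
  have hΨint : ∀ i, Integrable (Ψ i) μ := fun i =>
    Integrable.of_bound (hΨm i).aestronglyMeasurable ((2 * M) ^ 2)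
      (ae_of_all _ fun σ => by rw [Real.norm_eq_abs, abs_of_nonneg (hΨ0 i σ)]; exact hΨB i σ)
  have hΨki : ∀ i, Integrable (fun η => ∫ σ, Ψ i σ ∂(γ Λ η)) μ := fun i =>
    Integrable.of_bound ((hΨm i).stronglyMeasurable.integral_kernel (κ := κk)).aestronglyMeasurable
      ((2 * M) ^ 2) (ae_of_all _ fun η => by
        have := norm_integral_le_of_norm_le_const (μ := γ Λ η) (C := (2 * M) ^ 2) (f := Ψ i)
          (ae_of_all _ fun σ => by rw [Real.norm_eq_abs, abs_of_nonneg (hΨ0 i σ)]; exact hΨB i σ)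
        simpa only [probReal_univ, mul_one] using this)
  -- STEP 2 (inside one kernel): Holley–Stroock + Efron–Stein
  have hker : ∀ η, ∫ σ, (F σ - mF η) ^ 2 ∂(γ Λ η) ≤
      Real.exp c₁ * Real.exp c₁ * (1 / 2 : ℝ) * ∑ i : Λ, ∫ σ, Ψ i σ ∂(γ Λ η) := fun η =>
    integral_sub_sq_kernel_le (haarProbability G) Λ η hφm hφb (hosc η) hF hM
  -- STEP 1 (conditional variance = averaged kernel variance) and STEP 3 (DLR backwards)
  have hinner : ∀ η, ∫ σ, (F σ - mF σ) ^ 2 ∂(γ Λ η) = ∫ σ, (F σ - mF η) ^ 2 ∂(γ Λ η) :=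
    fun η => by
      refine integral_congr_ae ?_
      filter_upwards [hγ.proper Λ η] with σ hσ
      rw [hmFdep (fun e he => hσ e (fun h => he (Finset.mem_coe.2 h)))]
  have hint1 : Integrable (fun σ => (F σ - mF σ) ^ 2) μ :=
    Integrable.of_bound ((hF.sub hmFm).pow_const 2).aestronglyMeasurable ((2 * M) ^ 2)
      (ae_of_all _ fun σ => OrbitES.norm_sq_sub_le (hM σ) (hmFb σ))
  have hRi : Integrable (fun η => Real.exp c₁ * Real.exp c₁ * (1 / 2 : ℝ) *
      ∑ i : Λ, ∫ σ, Ψ i σ ∂(γ Λ η)) μ :=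
    (integrable_finsetSum _ fun i _ => hΨki i).const_mul _
  -- STEP 4 (Haar → heat bath, per link)
  have hlink : ∀ i : Λ, ∫ σ, Ψ i σ ∂μ ≤ Real.exp c₂ * hb ↑i := fun i =>
    HaarResample.integral_haar_le_exp_mul_integral_heatBath r β hMt0 hMt S hF hM ↑i
  have hK0 : 0 ≤ Real.exp c₁ * Real.exp c₁ * (1 / 2 : ℝ) := by positivity
  rw [hΛc]
  calc ∫ U, (F U - (μ[F|cylinderEvents (X := fun _ : Edge 4 (2 * S + 1) => G)
          ((↑Λ : Set (Edge 4 (2 * S + 1)))ᶜ)]) U) ^ 2 ∂μ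
      = ∫ U, (F U - mF U) ^ 2 ∂μ :=
        integral_congr_ae (by filter_upwards [hcond] with U hU; rw [hU])
    _ = ∫ η, ∫ σ, (F σ - mF σ) ^ 2 ∂(γ Λ η) ∂μ := (hGibbs.integral_integral_eq hγ Λ hint1).symm
    _ = ∫ η, ∫ σ, (F σ - mF η) ^ 2 ∂(γ Λ η) ∂μ := integral_congr_ae (ae_of_all _ hinner)
    _ ≤ ∫ η, Real.exp c₁ * Real.exp c₁ * (1 / 2 : ℝ) * ∑ i : Λ, ∫ σ, Ψ i σ ∂(γ Λ η) ∂μ :=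
        integral_mono_of_nonneg (ae_of_all _ fun η => integral_nonneg fun _ => sq_nonneg _) hRi
          (ae_of_all _ hker)
    _ = Real.exp c₁ * Real.exp c₁ * (1 / 2 : ℝ) * ∑ i : Λ, ∫ η, ∫ σ, Ψ i σ ∂(γ Λ η) ∂μ := by
        rw [integral_const_mul, integral_finsetSum _ fun i _ => hΨki i]
    _ = Real.exp c₁ * Real.exp c₁ * (1 / 2 : ℝ) * ∑ i : Λ, ∫ σ, Ψ i σ ∂μ := by
        congr 1
        exact Finset.sum_congr rfl fun i _ => hGibbs.integral_integral_eq hγ Λ (hΨint i)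
    _ ≤ Real.exp c₁ * Real.exp c₁ * (1 / 2 : ℝ) * ∑ i : Λ, Real.exp c₂ * hb ↑i :=
        mul_le_mul_of_nonneg_left (Finset.sum_le_sum fun i _ => hlink i) hK0
    _ = Real.exp c₁ * Real.exp c₁ * (1 / 2 : ℝ) * Real.exp c₂ * ∑ i : Λ, hb ↑i := by
        rw [← Finset.mul_sum]; ring
    _ = Real.exp c₁ * Real.exp c₁ * (1 / 2 : ℝ) * Real.exp c₂ *
        ∑ ℓ : Edge 4 (2 * S + 1), Set.indicator {ℓ : Edge 4 (2 * S + 1) | ℓ.1 ∈ Q} hb ℓ := by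
        congr 1
        rw [Finset.sum_coe_sort Λ hb, hΛ, Finset.sum_filter]
        refine Finset.sum_congr rfl fun ℓ _ => ?_
        by_cases h : ℓ.1 ∈ Q
        · rw [if_pos h, Set.indicator_of_mem (show ℓ ∈ {ℓ : Edge 4 (2 * S + 1) | ℓ.1 ∈ Q} from h)]
        · rw [if_neg h,
            Set.indicator_of_notMem (show ℓ ∉ {ℓ : Edge 4 (2 * S + 1) | ℓ.1 ∈ Q} from h)]

end Torus

end LocalPoincare

/-! ### The registered stub -/

/-- `stub_localPoincare_smallCylinders` — **per-volume Poincaré inequality for small cylinders,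
uniformly in the volume and in the exterior** (stub C3 of the line `maxcorr-halving`, the base
case of Martinelli's bisection). For every compact group `G` with a lattice representation `r`,
every real `β` and every size `m` there is `C = C(m, G, r, β)` (namely
`½ e^{2c₁ + c₂}`, `c₁ = |β| · 2 · (4m⁴ · 5 · #{planes}) (N + M_t)`,
`c₂ = |β| · 2 · (5 · #{planes}) (N + M_t)`, `M_t = sup |Re tr r.ρ|`) such that on every torus
`(ℤ/(2S+1))⁴`, for every cylinder `Q = {x | ∀ ν, (x ν − a ν).val < n ν}` with all sides `n ν ≤ m`
and every bounded measurable `F`: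
`E_μ(F − E_μ[F | links based outside Q])² ≤ C Σ_{ℓ based in Q} ∫∫ (F U − F(U[ℓ ↦ g]))² dν_ℓ^U(g) dμ(U)`,
`μ = wilsonMeasure r.ρ β`, `ν_ℓ^U = Haar.tilted (−β S_W(U[ℓ ↦ ·]))` the one-link heat-bath law
(`LocalPoincare.integral_sub_condExp_sq_le`). [folklore] -/
theorem stub_localPoincare_smallCylinders :
    ∀ (G : Type) [Group G] [TopologicalSpace G] [IsTopologicalGroup G] [CompactSpace G]
      [MeasurableSpace G] [BorelSpace G] (r : LatticeRep G) (β : ℝ),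
      ∀ m : ℕ, ∃ C : ℝ, ∀ (S : ℕ) (μW : Measure (GaugeConfig 4 (2 * S + 1) G)),
        μW = (wilsonMeasure r.ρ β : Measure (GaugeConfig 4 (2 * S + 1) G)) →
        ∀ (a : Fin 4 → ZMod (2 * S + 1)) (n : Fin 4 → ℕ), (∀ ν, n ν ≤ m) → (∀ ν, n ν ≤ 2 * S + 1) →
        ∀ (Q : Set (Site 4 (2 * S + 1))), Q = {x | ∀ ν, (x ν - a ν).val < n ν} →
        ∀ F : GaugeConfig 4 (2 * S + 1) G → ℝ, Measurable F → (∃ M : ℝ, ∀ U, |F U| ≤ M) →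
        ∫ U, (F U - condExp (cylinderEvents {ℓ : Edge 4 (2 * S + 1) | ℓ.1 ∉ Q}) μW F U) ^ 2 ∂μW ≤
          C * ∑ ℓ : Edge 4 (2 * S + 1), Set.indicator {ℓ : Edge 4 (2 * S + 1) | ℓ.1 ∈ Q}
            (fun ℓ => ∫ U, ∫ g, (F U - F (Function.update U ℓ g)) ^ 2
              ∂((haarProbability G).tilted (fun g' => -β * wilsonAction r.ρ (Function.update U ℓ g'))) ∂μW) ℓ := by
  intro G _ _ _ _ _ _ r β m
  obtain ⟨Mt, hMt0, hMt⟩ := exists_bound_trace_re_nonneg r.ρ r.continuous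
  refine ⟨Real.exp (|β| * (2 * (((4 * m ^ 4 * (4 + 1) *
      Fintype.card {q : Fin 4 × Fin 4 // q.1 < q.2} : ℕ) : ℝ) * ((r.N : ℝ) + Mt)))) *
    Real.exp (|β| * (2 * (((4 * m ^ 4 * (4 + 1) *
      Fintype.card {q : Fin 4 × Fin 4 // q.1 < q.2} : ℕ) : ℝ) * ((r.N : ℝ) + Mt)))) *
    (1 / 2 : ℝ) *
    Real.exp (|β| * (2 * ((((4 + 1) * Fintype.card {q : Fin 4 × Fin 4 // q.1 < q.2} : ℕ) : ℝ) *
      ((r.N : ℝ) + Mt)))), fun S μW hμW a n hnm _hnS Q hQ F hF hbd => ?_⟩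
  obtain ⟨M, hM⟩ := hbd
  subst hμW
  exact LocalPoincare.integral_sub_condExp_sq_le r β hMt0 hMt S a n hnm Q hQ hF hM

end Summit.QuantumFields.YangMills.Theorems.SusceptibilityToPoincare

end
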